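import Summits.FinalStateConjecture.FinalStateConjecture.Statement
import Summits.FinalStateConjecture.FinalStateConjecture.Theorems.SeamedChartsExhaust.Negative.ReversedFlatChart
import Literature.Barriers.FinalStateConjecture.KerrSuperradiance
import Literature.Geometry.Lorentzian.KerrDataProofs
import Literature.Geometry.Lorentzian.KerrSchildCoord

/-!
# Disproof of `FutureOrientedOfSeamed` (crux stmt-FinalStateConjecture-17576, route StarvedNecks) — findings

Standing disprover's work file (cdisprove, cycle 1, 2026-08-17). VERDICT SO FAR: **no kill; the crux is true on
paper and robustly so.** Index of kernel-checked content (prose only in docstrings):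

* §A LOAD-BEARING ANALYSIS.
  - `FutureOrientedOfSeamedWithoutCoreD` / `futureOrientedOfSeamed_false_without_coreD`: HonestCore (d)
    (flat chart `dΦ(∂₀)` future-directed) is LOAD-BEARING — delete it and the spacetime-level statement is false
    (time-reversed flat chart on Minkowski, `N = 0`; conjunct (iii) fails). LANDED as
    `Theorems/FutureOrientedOfSeamed/Negative/WithoutFlatOrientation.lean` (p133263).
  - SEAMED (5) (future hole time-lines on the certified tubes) is NOT load-bearing: on the OPEN anchor shell
    `Aᵢ = {τ₀ < t*ᵢ, Rᵢ(t*ᵢ) − 2 < rᵢ < Rᵢ(t*ᵢ)}` clauses (8), (9), (12) force the ONE-ATLAS hypotheses of (6)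
    POINTWISE (`oneAtlas_hypotheses_on_anchorShell`, `isOpen_anchorShell`, `chart_eq_flatChart_on_anchorShell`),
    so `Ψᵢ = Φ` on an open set, `dΨᵢ = dΦ` there, and HonestCore (d) + SEAMED (3)/(4) + orthochronous `Λᵢ`
    orient `dΨᵢ(Λᵢe₀)` exactly as (5) does — this answers the "no continuity of `d.excision`" objection
    (ideator-2 negative notes (γ)); information for the prover, the cheap proof still uses (5).
  - Everything else is decoration for THIS item (kernel-checked by the r-attack seat, evidence W.lean
    `futureOrientedOfSeamed_of_slabPropagation`, and by the picked line's
    `futureOrientedOfSeamed_of_slabOrientationFromAnchor`): `O = exteriorOf`, admissibility, maximality,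
    HonestCore (b), (c), sub-extremality beyond `0 < M`, SEAMED (2)–(4), (6)–(12).
  - HonestCore (b) (anchoring) carries the hole charts' time direction only through GLOBAL causality: in the
    time-REVERSED exact Schwarzschild exterior with the inclusion chart (b) fails because `t*` is a time function
    (`SeamedChartsExhaust/Negative/KerrSchildTimeFunction.lean`), but in a general spacetime (b) cannot be
    converted into a sign without achronality of late slab images; so no single-clause deletion other than (d)
    is refutable by a causally well-behaved model, and (b)+(d)+(5) must ALL go before the reversed-Kerr inclusion
    chart becomes a countermodel (three clauses: weak information, not built).
* §B TIGHTNESS. None of the numerical thresholds is sharp for this item: the sign argument needs only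
  `H = Mr³/(r⁴ + a²z²) < 1/4` at the anchor (given: `≤ 1/100` at `r ≥ R₀ ≥ 100M`) and `Rᵢ ≥ R₀ + 4 > r₊` (anchors
  exist on every late slab); `100M ≤ R₀` could be weakened to `2M < R₀` for THIS item (recorded, not filed —
  the thresholds serve the sibling cruxes). NOT BOOST-COVARIANT (remark for the S-side, harmless for F, which
  only becomes more vacuous): on exact boosted Schwarzschild with identity charts the FLAT deviation at the tube
  wall is `(g_B − η)(x) = 2H (ℓ∘Λ⁻¹) ⊗ (ℓ∘Λ⁻¹)`, of operator norm `≈ 4H‖Λ‖² ≈ 4(M/ρ)(1+v)/(1−v)` on the trailing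
  side, so the ABSOLUTE flat threshold `1/10` of SEAMED (3) (with ONE ATLAS (6), which glues the flat chart to
  the hole chart on the collar) forces the seam radii `ρᵢ, R₀' ≳ 40‖Λᵢ‖² Mᵢ` — `R₀' = 100M` only tolerates
  `v ≲ 0.43`; at the route's test boost `v = 0.9` (`‖Λ‖² = 19`) one needs `R₀' ≳ 760M`. `NecksCertifyR` may
  choose `R₀'` (it is existential there), so nothing breaks; but "thresholds scale-covariant, big boosts only
  delay eventually" (r-attack note) is true of (4), not of (3).
* §C NATURAL STRENGTHENINGS. `naiveField_not_futureDirected`: the variant of conjunct (ii) with the frozen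
  vector `Λᵢe₀` in place of `ΛᵢV` is false on exact rotating Kerr (`∂_{t*}` is spacelike in the ergoregion,
  `kerr_ergoregion_nonempty`), which is why the Statement uses `V = −g♯(dt*)`; (ii) "for all `τ > τ₀`" instead of
  "eventually" and (ii) "uniformly in `ρ`" are NOT consequences of the hypotheses (the chart is uncontrolled
  inside `r < R₀` at early-late times and beyond `Rᵢ + 1` at all times) — countermodels need a sheared hole
  chart on exact Schwarzschild (not built this cycle; no prover needs them).
* §D TARGETS (line `Sketch` = ideator 2 `clock-duality-rays`, PICKED 2026-08-17): the transfer statement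
  `SlabOrientationFromAnchor` (C⁺) was read adversarially — no embedding/orthochronous hypothesis is needed
  (`g_B(Λe₀, ΛV) = g_{M,a}(e₀, V) = −1` for every `Λ`), rays stay in the slab by `radiusRayMonotone` and reach
  the anchor sphere by the IVT in both directions (`r(τ, 0) = 0 < R₀`, `r → ∞` outward), continuity of
  `Kerr.timeVector` on `{r > 0}` needs no `Kerr.Facts`; C⁺ is TRUE on paper. No stuck stubs yet.
* §E NEAR-MISSES: none (nothing sorried).

WHY IT RESISTS (for provers): conjunct (i) = HonestCore (a).2.2 and (iii) = HonestCore (d) literally; conjunct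
(ii) is a continuity/connectedness transfer inside ONE chart whose timelikeness margin is uniform
(`g_B(ΛV, ΛV) = −1 − 2H ≤ −1`, `‖V‖ ≤ 3` on `r > r₊ ≥ M`) and whose sign is fixed at the SEAMED (5) anchors —
and, redundantly, by ONE ATLAS + HonestCore (d) (§A) and by causal anchoring (b) in any causal development.
A counterexample would need a late truncated slab on which `dΨᵢ(ΛᵢV)` goes null (excluded eventually by the
structure's own fixed-radius convergence) or a disconnected slab (the Kerr–Schild shells `{t* = τ, r₊ < r ≤ ρ}`
are connected; the picked line even avoids this via radial rays).
-/

noncomputable section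

open TopologicalSpace Manifold Filter Topology Set Function
open scoped ContDiff Topology ENNReal Manifold

-- `<Problem> = <Summit>` doubles the namespace component (tree-wide convention, cf. lakefile)
set_option linter.dupNamespace false
-- instance search through nested operator types `E4 →L E4 →L ℝ` (as in the tree files)
set_option maxSynthPendingDepth 3

namespace Summit.FinalStateConjecture.FinalStateConjecture.Cruxes.FutureOrientedOfSeamed.Disproof

open Literature.Geometry.Lorentzian LorentzianMetric
open Summit.FinalStateConjecture.FinalStateConjecture.Theorems.SeamedChartsExhaust.Negative

/-! ## §A Load-bearing analysis -/

/-- **The crux with HonestCore (d) deleted** (spacetime-level form, as in the sibling negative lemmas of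
`SeamedChartsExhaust/Negative`): for every spacetime `𝓢`, sets `Σ, O`, `C²` decomposition `d` of `O`, radii
`R, R₀` with `O = J⁺(Σ) ∩ I⁻(d.charted)`, HonestCore (a), (b), (c) and SEAMED (1)–(12) verbatim,
`IsFutureOriented d`. (The MGHD-level deletion — keep `D`, `𝒟`, `O = exteriorOf` — is not refutable in the
tree, which constructs no MGHD; the flat chart's time direction is equally unconstrained there.) -/
def FutureOrientedOfSeamedWithoutCoreD : Prop :=
  ∀ (𝓢 : Spacetime.{0} 4) (S₀ O : Set 𝓢.carrier) (d : FinalStateDecomposition 𝓢 O 2)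
      (R : Fin d.N → ℝ → ℝ) (R₀ : ℝ),
    O = 𝓢.metric.causalFuture 𝓢.timeOrientation S₀ ∩
      𝓢.metric.chronologicalPast 𝓢.timeOrientation d.charted →
    -- HonestCore (a)
    (∀ i, Kerr.IsSubextremal (d.mass i) (d.spin i) ∧ 100 * d.mass i ≤ R₀ ∧
      0 < ((d.motion i).1 : E4 ≃L[ℝ] E4) (E4.basisVector 0) 0) →
    -- HonestCore (b): anchoring
    (∀ i (ϱ τ₂ : ℝ), R₀ ≤ ϱ → d.τ₀ < τ₂ →
      d.chart i '' {x | d.τ₀ < (d.background i).time x.1 ∧ (d.background i).time x.1 < τ₂ ∧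
          (d.background i).radius x.1 < ϱ} ⊆
        𝓢.metric.causalPast 𝓢.timeOrientation (d.chart i '' (d.background i).truncTimeSlab ϱ τ₂)) →
    -- HonestCore (c): relative closedness
    (∀ i (τ' : ℝ) (ϱ : ℝ → ℝ), Continuous ϱ → d.τ₀ < τ' →
      closure (d.chart i '' {x | τ' ≤ (d.background i).time x.1 ∧
          (d.background i).radius x.1 ≤ ϱ ((d.background i).time x.1)}) ∩ O ⊆
        d.chart i '' {x | τ' ≤ (d.background i).time x.1 ∧
          (d.background i).radius x.1 ≤ ϱ ((d.background i).time x.1)}) →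
    -- SEAMED (1)
    (∀ i, Monotone (R i) ∧ Continuous (R i) ∧ ∀ s, R₀ + 4 ≤ R i s ∧ R₀ ≤ d.excision i s) →
    -- SEAMED (2)
    (∀ i, Tendsto (fun τ ↦ 𝓢.truncDeviationCk (d.background i) (d.chart i) 2 (R i τ) τ) atTop (𝓝 0)) →
    -- SEAMED (3)
    supCkENorm (Subtype.val '' {y : d.flatDomain | d.τ₀ ≤ y.1 0}) 0
        (𝓢.deviationExtend (Minkowski.backgroundOn d.flatDomain) d.flatChart) ≤ 10⁻¹ →
    -- SEAMED (4)
    (∀ i, supCkENorm (Subtype.val '' {x : (d.background i).domain |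
        (d.τ₀ ≤ (d.background i).time x.1 ∨ d.τ₀ ≤ x.1 0) ∧ R₀ ≤ (d.background i).radius x.1 ∧
          (d.background i).radius x.1 ≤ R i ((d.background i).time x.1)}) 0
        (𝓢.deviationExtend (d.background i) (d.chart i)) ≤
        ENNReal.ofReal (1 / (10 * ‖(((d.motion i).1 : E4 ≃L[ℝ] E4) : E4 →L[ℝ] E4)‖ ^ 2))) →
    -- SEAMED (5)
    (∀ i (x : (d.background i).domain), (d.τ₀ ≤ (d.background i).time x.1 ∨ d.τ₀ ≤ x.1 0) →
      R₀ ≤ (d.background i).radius x.1 → (d.background i).radius x.1 ≤ R i ((d.background i).time x.1) →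
      𝓢.timeOrientation.IsFutureDirected
        (mfderiv 𝓘(ℝ, E4) (𝓡 4) (d.chart i) x (((d.motion i).1 : E4 ≃L[ℝ] E4) (E4.basisVector 0)))) →
    -- SEAMED (6): one atlas
    (∀ i (y : E4) (hy : y ∈ (d.background i).domain), d.τ₀ ≤ y 0 →
      (∀ j, d.excision j (y 0) < (d.background j).radius y) →
      (d.background i).radius y ≤ R i ((d.background i).time y) + 1 →
      ∃ hy' : y ∈ d.flatDomain, d.chart i ⟨y, hy⟩ = d.flatChart ⟨y, hy'⟩) →
    -- SEAMED (7)
    (∀ y : d.flatDomain, d.τ₀ ≤ y.1 0 → ∀ j, d.excision j (y.1 0) < (d.background j).radius y.1) →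
    -- SEAMED (8)
    (∀ j (y : E4), d.τ₀ ≤ y 0 → (d.background j).radius y ≤ d.excision j (y 0) →
      (d.background j).radius y + 2 ≤ R j ((d.background j).time y)) →
    -- SEAMED (9)
    (∀ j (y : E4), d.τ₀ ≤ (d.background j).time y →
      (d.background j).radius y ≤ R j ((d.background j).time y) + 2 → (d.background j).time y ≤ y 0) →
    -- SEAMED (10)
    (∀ j, d.chart j '' {x | d.τ₀ < (d.background j).time x.1 ∧
        R j ((d.background j).time x.1) + 1 < (d.background j).radius x.1} ⊆ d.radiationZone) →
    -- SEAMED (11)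
    (∀ τ' : ℝ, d.τ₀ < τ' → closure (d.flatChart '' {y | τ' ≤ y.1 0}) ⊆
      d.flatChart '' {y | τ' ≤ y.1 0} ∪
        ⋃ j, d.chart j '' {x | τ' ≤ x.1 0 ∧ (d.background j).radius x.1 = d.excision j (x.1 0)}) →
    -- SEAMED (12)
    (∀ j j' (y : E4), j ≠ j' → (d.τ₀ ≤ y 0 ∨ d.τ₀ ≤ (d.background j).time y) →
      (d.background j).radius y ≤ R j ((d.background j).time y) + 1 →
      R j' ((d.background j').time y) + 1 < (d.background j').radius y) →
    IsFutureOriented d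

/-- The time-reversed flat chart on Minkowski spacetime (`ReversedModel.decomp`: `N = 0`, `Φ(y) = (−y⁰, y̲)`,
`τ₀ = 0`, `O = {x⁰ < 0}`) is NOT future-oriented: on every flat slab `dΦ(∂₀) = −∂₀` is past-directed
(`η(∂₀, −∂₀) = 1 > 0`), so conjunct (iii) fails (tested at the slab point `τ∂₀`). O'Neill 1983, Ch. 5, p. 145. [folklore] -/
theorem not_isFutureOriented_reversedDecomp : ¬ IsFutureOriented ReversedModel.decomp := by
  rintro ⟨-, -, h3⟩
  obtain ⟨τ, hτ⟩ := h3.exists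
  have hx : (⟨τ • E4.basisVector 0, trivial⟩ : (⊤ : Opens E4)) ∈ (Minkowski.backgroundOn ⊤).timeSlab τ := by
    show (τ • E4.basisVector 0 : E4) 0 = τ
    simp
  have h := (hτ ⟨τ • E4.basisVector 0, trivial⟩ hx).2
  change Minkowski.bilin (E4.basisVector 0)
    (mfderiv 𝓘(ℝ, E4) (𝓡 4) ReversedModel.Φ ⟨τ • E4.basisVector 0, trivial⟩ (E4.basisVector 0)) < 0 at h
  rw [ReversedModel.mfderiv_Φ_apply, Minkowski.bilin_basisVector_zero_left, ReversedModel.T_apply_zero] at h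
  simp at h
  linarith

/-- **HonestCore (d) is load-bearing** ("any proof must use (d)"): the crux with (d) deleted is false — the
reversed flat chart on Minkowski spacetime satisfies `O = J⁺(ℝ⁴) ∩ I⁻(charted)` (`ReversedModel.O_eq`), HonestCore
(a)–(c) and SEAMED (1), (2), (4)–(10), (12) vacuously (`N = 0`), SEAMED (3) (zero deviation) and (11) (closed
half-spaces), and is not future-oriented. Landed verbatim (statement inlined) as
`Theorems.FutureOrientedOfSeamed.Negative.not_forall_isFutureOriented_without_flatOrientation` (p133263).
O'Neill 1983, Ch. 5, p. 145. [folklore] -/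
theorem futureOrientedOfSeamed_false_without_coreD : ¬ FutureOrientedOfSeamedWithoutCoreD := by
  intro h
  refine not_isFutureOriented_reversedDecomp
    (h Minkowski.spacetime univ ReversedModel.O ReversedModel.decomp Fin.elim0 0 ReversedModel.O_eq
      (fun i ↦ i.elim0) (fun i ↦ i.elim0) (fun i ↦ i.elim0) (fun i ↦ i.elim0) (fun i ↦ i.elim0) ?_
      (fun i ↦ i.elim0) (fun i ↦ i.elim0) (fun i ↦ i.elim0) (fun _ _ j ↦ j.elim0) (fun j ↦ j.elim0)
      (fun j ↦ j.elim0) (fun j ↦ j.elim0) ?_ (fun j ↦ j.elim0))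
  · show supCkENorm _ 0 (Minkowski.spacetime.deviationExtend (Minkowski.backgroundOn ⊤) ReversedModel.Φ) ≤ 10⁻¹
    rw [ReversedModel.deviationExtend_Φ, supCkENorm_zero]
    exact zero_le
  · intro τ' _ x hx
    have hc : IsClosed {x : E4 | x 0 ≤ -τ'} :=
      isClosed_le (PiLp.continuous_apply 2 _ 0) continuous_const
    have hx' : x ∈ closure (ReversedModel.Φ '' {y : (⊤ : Opens E4) | τ' ≤ y.1 0} : Set E4) := hx
    rw [ReversedModel.image_Φ_ge, hc.closure_eq] at hx'
    left
    show x ∈ (ReversedModel.Φ '' {y : (⊤ : Opens E4) | τ' ≤ y.1 0} : Set E4)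
    rw [ReversedModel.image_Φ_ge]
    exact hx'

/-! ### SEAMED (5) is not load-bearing: the open anchor shell

For hole `i` put `Aᵢ := {y ∈ Uᵢ | τ₀ < t*ᵢ(y), Rᵢ(t*ᵢ y) − 2 < rᵢ(y) < Rᵢ(t*ᵢ y)}` (an OPEN subset of the chart
domain, `isOpen_anchorShell`, since `Rᵢ` is continuous by SEAMED (1) and `t*ᵢ, rᵢ` are continuous). Clauses
(8), (9), (12) force, at EVERY point of `Aᵢ`, the three hypotheses of ONE ATLAS (6) — flat-lateness `τ₀ ≤ y⁰`,
`ρⱼ(y⁰) < rⱼ(y)` for all `j` (NO continuity of `ρⱼ = d.excision j` is used: (8) is applied pointwise and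
contradicts `rᵢ > Rᵢ − 2`, resp. (12)), and `rᵢ ≤ Rᵢ + 1` — so `Ψᵢ = Φ` on the open set `Aᵢ`
(`chart_eq_flatChart_on_anchorShell`), hence `dΨᵢ = dΦ` on `Aᵢ` (locality of `mfderiv`), and HonestCore (d)
(`dΦ(e₀)` future) + SEAMED (4) (`C⁰` threshold `1/(10‖Λᵢ‖²)` on `R₀ ≤ rᵢ ≤ Rᵢ`, which contains `Aᵢ` as
`Rᵢ − 2 ≥ R₀ + 2`) + orthochronous `Λᵢ` (`g_B(Λᵢe₀, e₀) = −(Λᵢe₀)⁰(1 − O(H)) < 0`) make `dΨᵢ(Λᵢe₀)`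
future-directed on `Aᵢ`: an anchor on every late slab `t*ᵢ = τ` at radii `(Rᵢ(τ) − 2, Rᵢ(τ))`, i.e. SEAMED (5)
restricted to where the proof needs it. Consequently deleting (5) alone does NOT falsify the crux (no
`_false_without_seamed5` exists); the prover may still use (5), which is cheaper. -/

/-- **Pointwise one-atlas hypotheses on the anchor shell** (pure order bookkeeping over SEAMED (8), (9), (12)):
if `τ₀ ≤ t*ᵢ(y)` and `Rᵢ(t*ᵢ y) − 2 < rᵢ(y) ≤ Rᵢ(t*ᵢ y)` then `τ₀ ≤ y⁰`, `ρⱼ(y⁰) < rⱼ(y)` for every hole `j`, and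
`rᵢ(y) ≤ Rᵢ(t*ᵢ y) + 1`. [folklore] -/
theorem oneAtlas_hypotheses_on_anchorShell {𝓢 : Spacetime.{0} 4} {O : Set 𝓢.carrier} {k : ℕ}
    (d : FinalStateDecomposition 𝓢 O k) (R : Fin d.N → ℝ → ℝ)
    (h8 : ∀ j (y : E4), d.τ₀ ≤ y 0 → (d.background j).radius y ≤ d.excision j (y 0) →
      (d.background j).radius y + 2 ≤ R j ((d.background j).time y))
    (h9 : ∀ j (y : E4), d.τ₀ ≤ (d.background j).time y →
      (d.background j).radius y ≤ R j ((d.background j).time y) + 2 → (d.background j).time y ≤ y 0)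
    (h12 : ∀ j j' (y : E4), j ≠ j' → (d.τ₀ ≤ y 0 ∨ d.τ₀ ≤ (d.background j).time y) →
      (d.background j).radius y ≤ R j ((d.background j).time y) + 1 →
      R j' ((d.background j').time y) + 1 < (d.background j').radius y)
    (i : Fin d.N) (y : E4) (ht : d.τ₀ ≤ (d.background i).time y)
    (hlo : R i ((d.background i).time y) - 2 < (d.background i).radius y)
    (hhi : (d.background i).radius y ≤ R i ((d.background i).time y)) :
    d.τ₀ ≤ y 0 ∧ (∀ j, d.excision j (y 0) < (d.background j).radius y) ∧
      (d.background i).radius y ≤ R i ((d.background i).time y) + 1 := by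
  have hty : (d.background i).time y ≤ y 0 := h9 i y ht (by linarith)
  have hy0 : d.τ₀ ≤ y 0 := ht.trans hty
  refine ⟨hy0, fun j ↦ ?_, by linarith⟩
  by_contra hcon
  push Not at hcon
  by_cases hji : j = i
  · subst hji
    have := h8 j y hy0 hcon
    linarith
  · have hfar := h12 i j y (Ne.symm hji) (Or.inl hy0) (by linarith)
    have := h8 j y hy0 hcon
    linarith

/-- **The anchor shell is open** in `E4` (continuity of `Rᵢ` — SEAMED (1) —, of the rest-frame clock
`t*ᵢ = (Λᵢ⁻¹(· − cᵢ))⁰` and of the Kerr–Schild radius `rᵢ = r(Λᵢ⁻¹(· − cᵢ))`). [folklore] -/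
theorem isOpen_anchorShell {𝓢 : Spacetime.{0} 4} {O : Set 𝓢.carrier} {k : ℕ}
    (d : FinalStateDecomposition 𝓢 O k) (R : Fin d.N → ℝ → ℝ) (hR : ∀ i, Continuous (R i)) (i : Fin d.N) :
    IsOpen {y : E4 | y ∈ (d.background i).domain ∧ d.τ₀ < (d.background i).time y ∧
      R i ((d.background i).time y) - 2 < (d.background i).radius y ∧
      (d.background i).radius y < R i ((d.background i).time y)} := by
  have ht : Continuous (d.background i).time :=
    (PiLp.continuous_apply 2 _ 0).comp (continuous_poincareInv _ _)
  have hr : Continuous (d.background i).radius :=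
    (Kerr.continuous_radius _).comp (continuous_poincareInv _ _)
  have hRt : Continuous fun y ↦ R i ((d.background i).time y) := (hR i).comp ht
  refine (d.background i).domain.isOpen.inter ((isOpen_lt continuous_const ht).inter
    ((isOpen_lt (hRt.sub continuous_const) hr).inter (isOpen_lt hr hRt)))

/-- **ONE ATLAS applies at every point of the anchor shell**: under SEAMED (6), (8), (9), (12), for `y ∈ Aᵢ`
the hole chart and the flat chart agree at `y` (so, `Aᵢ` being open, they agree to all orders there). [folklore] -/
theorem chart_eq_flatChart_on_anchorShell {𝓢 : Spacetime.{0} 4} {O : Set 𝓢.carrier} {k : ℕ}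
    (d : FinalStateDecomposition 𝓢 O k) (R : Fin d.N → ℝ → ℝ)
    (h6 : ∀ i (y : E4) (hy : y ∈ (d.background i).domain), d.τ₀ ≤ y 0 →
      (∀ j, d.excision j (y 0) < (d.background j).radius y) →
      (d.background i).radius y ≤ R i ((d.background i).time y) + 1 →
      ∃ hy' : y ∈ d.flatDomain, d.chart i ⟨y, hy⟩ = d.flatChart ⟨y, hy'⟩)
    (h8 : ∀ j (y : E4), d.τ₀ ≤ y 0 → (d.background j).radius y ≤ d.excision j (y 0) →
      (d.background j).radius y + 2 ≤ R j ((d.background j).time y))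
    (h9 : ∀ j (y : E4), d.τ₀ ≤ (d.background j).time y →
      (d.background j).radius y ≤ R j ((d.background j).time y) + 2 → (d.background j).time y ≤ y 0)
    (h12 : ∀ j j' (y : E4), j ≠ j' → (d.τ₀ ≤ y 0 ∨ d.τ₀ ≤ (d.background j).time y) →
      (d.background j).radius y ≤ R j ((d.background j).time y) + 1 →
      R j' ((d.background j').time y) + 1 < (d.background j').radius y)
    (i : Fin d.N) (y : E4)
    (hy : y ∈ {y : E4 | y ∈ (d.background i).domain ∧ d.τ₀ < (d.background i).time y ∧
      R i ((d.background i).time y) - 2 < (d.background i).radius y ∧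
      (d.background i).radius y < R i ((d.background i).time y)}) :
    ∃ (hU : y ∈ (d.background i).domain) (hy' : y ∈ d.flatDomain), d.chart i ⟨y, hU⟩ = d.flatChart ⟨y, hy'⟩ := by
  obtain ⟨hU, ht, hlo, hhi⟩ := hy
  obtain ⟨hy0, hj, h1⟩ := oneAtlas_hypotheses_on_anchorShell d R h8 h9 h12 i y ht.le hlo hhi.le
  exact ⟨hU, h6 i y hU hy0 hj h1⟩

/-! ## §C Natural strengthenings -/

/-- `Kerr.Facts` is inhabited (its three fields are theorems in the tree); scoped here as in
`SeamedChartsExhaust/Negative/ExactSchwarzschildModel.lean`. [folklore] -/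
scoped instance kerrFacts : Kerr.Facts :=
  ⟨Kerr.isConnected_region_holds, Kerr.contMDiff_bilin_holds, Kerr.contMDiff_timeVector_holds⟩

/-- **The frozen field `Λe₀` cannot replace `ΛV` in conjunct (ii).** On the exact rotating Kerr exterior
(`Kerr.exteriorSpacetime M a`, `M > 0`, `a ≠ 0`) with the inclusion chart, `d(id)(e₀) = ∂_{t*}` is NOT
future-directed causal at an ergoregion point (`g(∂_{t*}, ∂_{t*}) = −1 + 2H > 0` there;
`kerr_ergoregion_nonempty`), although that chart is honestly future-oriented for `V = −g♯(dt*)`. So the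
natural strengthening of `IsFutureOriented` (ii) with `Λᵢe₀` — the vector SEAMED (5) uses on `r ≥ R₀` — is false
down to the horizon; the Statement's `V` is necessary. O'Neill 1995, Ch. 2, §2.4. [folklore] -/
theorem naiveField_not_futureDirected {M a : ℝ} (hM : 0 < M) (ha : a ≠ 0) :
    ∃ x : (Kerr.exteriorSpacetime M a hM.le).carrier,
      ¬ (Kerr.exteriorSpacetime M a hM.le).timeOrientation.IsFutureDirected (x := x) (E4.basisVector 0) := by
  obtain ⟨x, hx, hpos⟩ := Literature.Barriers.FinalStateConjecture.kerr_ergoregion_nonempty hM ha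
  refine ⟨⟨x, hx⟩, fun h ↦ ?_⟩
  have h1 := h.1.1
  change Kerr.bilin M a x (E4.basisVector 0) (E4.basisVector 0) ≤ 0 at h1
  exact absurd hpos (not_lt.mpr h1)

end Summit.FinalStateConjecture.FinalStateConjecture.Cruxes.FutureOrientedOfSeamed.Disproof

end
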